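import Literature.NumberTheory.Automorphic.UnitaryCurveHolCotFormsLevelFinite
import Summits.HodgeConjecture.HodgeConjecture.Theorems.HLiu418S1BettiSliceExclusion
import Summits.HodgeConjecture.HodgeConjecture.Theorems.HLiu418CurveHodgeTypesDisjoint
import Literature.NumberTheory.Automorphic.AdelicUnitaryGroupDatum
import HarnessLib

/-!
# Crux `HLiu418`, K-lane E₂ — the ADMISSIBILITY cut S3₂: an irreducible smooth `σ` realised equivariantly and non-trivially in the
# cone-holomorphic cotangent forms of the unitary Shimura CURVES is admissible (PROVED, chart-free, compact-quotient route (R2′))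

Cell `hodgecm-mathlib`, FLOOR 0, programme P5 (`F0_AlbCm`); crux item `stmt-HodgeConjecture-24832` (`HCCMUnconditional.HLiu418`); seat F0P5-p04 (g2),
`--supports stmt-HodgeConjecture-24832` (helper).  THEOREMS ONLY — no definition, no instance, no notation, no named-fact hypothesis, no `sorry`.
K-lane of the P5 named fact E₂ `UnitaryCurveForms.cohIsotypicLine₂_hol` (hypothesis `hEh` of ★ `F0AlbCmS1BettiHolds` ∕ `…Signed`; parent named-fact stub
`stub_E₂hol`): F0P5-p02 (g2)'s census `F0/P5/p02/CENSUS-KE2-cohIsotypicLine2` cuts E₂ into S2⁺₂ (archimedean orthogonality), S2β₂ (density, ★ p800606)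
and **S3₂ (admissibility)** — this file closes S3₂.

MATHEMATICS ([BorelJacquet1979, §4.3 (i)]: automorphic forms of a fixed type span a finite-dimensional space — Harish-Chandra; here the elementary
compact-quotient case, [Borel1997, §8]; admissibility [BernsteinZelevinsky1976, 2.1]).  Let `σ` be an irreducible smooth representation of
`U(H)(𝔸_{L⁺,f})` on `W` and `ψ : W → (U(H)(𝔸_{L⁺}) → ℂ)` a NON-ZERO linear map, equivariant for right translation (★ `rightRep₂`), with values in the
cone-holomorphic cotangent forms `holCotForms₂ … 𝔣` (★ `UnitaryCurveCohCotangentForms`).  Then `σ` is ADMISSIBLE: `ψ` is injective (Schur: its kernel is a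
proper invariant subspace), and for every compact open `K` it maps the `K`-fixed vectors `W^K` into the right-`K`-invariant holomorphic cotangent forms,
a FINITE-DIMENSIONAL space by ★ `UnitaryCurveForms.finite_holCotForms₂_inf_fixedPoints` (compact quotient by anisotropy of `H` — ★
`compactSpace_cmDatum_automorphicQuotient`, anisotropy from the rational frame and definiteness off `ι` as in ★ `S1BettiSliceExclusion.anisotropic_of_formCongr_posDef`
— Arzelà–Ascoli for the equicontinuous sup-unit-ball, Montel on the cone-open for the closedness, Riesz).

HONEST SCOPE.  The cone machinery (★ `UnitaryCurveConeExtension` Witt factorisation, ★ `UnitaryCurveConeModulus`) needs `σ_{w₁} H` HERMITIAN; the E₂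
letter's binder prefix (copied by the census cut `AdmissibleOfHolValuedType₂`) quantifies over ALL `t ≠ 0` with `ᵗ(c g)(t • H) g = diag dV`, which makes
`t • H` `c`-hermitian but `H` itself hermitian only when `c t = t`.  We therefore prove the cut WITH the hermitian hypothesis (`isAdmissible_of_holValued`,
binder `hJ`) and in the form keyed on `(ι t).im = 0` (`isAdmissible_of_holValued_of_im_eq_zero`, via ★ `CurveHodgeTypesDisjoint.isHermitian_map_of_formCongr`)
— the binder `_hτt' : (ι₁ t).im = 0` IS present in every consumer prefix (`S1BettiShape`, `S1MultOneFormsShape`, `S1bHodgeShape`), so this is the form the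
E₂ head can use; the `μ`, `P`, `P.ContainsFun` data of the cut are not needed and enter only as unused binders of the second form.
HC_CM is proved only modulo the 7 printed citations until rung 0 closes; this file discharges none of them by itself (it is one of three cuts of E₂).

## References
* [BorelJacquet1979] A. Borel, H. Jacquet, *Automorphic forms and automorphic representations*, PSPM 33.1 (1979), §4.2–§4.3, §4.6.
* [Borel1997] A. Borel, *Automorphic forms on SL₂(ℝ)*, Cambridge Tracts in Math. 130 (1997), §5.14, §8.
* [BernsteinZelevinsky1976] I. N. Bernstein, A. V. Zelevinsky, Russian Math. Surveys 31 (1976), §2.1 (admissible representations).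
* [HormanderSCV1973] L. Hörmander, *An Introduction to Complex Analysis in Several Variables* (1973), Thm. 2.2.7.
-/

set_option autoImplicit false
-- the mandated namespace repeats `HodgeConjecture.HodgeConjecture`, as in every `Theorems/*.lean` of this sub-problem
set_option linter.dupNamespace false

noncomputable section

namespace Summit.HodgeConjecture.HodgeConjecture.Cruxes.HLiu418.E2Admissible

open NumberField NumberField.InfinitePlace MeasureTheory
open scoped Matrix ComplexOrder
open Literature.NumberTheory.Automorphic Literature.NumberTheory.Automorphic.UnitaryGroup
open Literature.NumberTheory.Automorphic.UnitaryCurveForms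
open Literature.AlgebraicGeometry.ShimuraVarieties

/-- Schur: a non-zero linear map out of an irreducible representation intertwining it with some action is injective (its kernel is a proper
invariant subspace). [cite: BernsteinZelevinsky1976, §2.1] -/
private theorem injective_of_isIrreducible {G V X : Type*} [Group G] [AddCommGroup V] [Module ℂ V] [AddCommGroup X] [Module ℂ X]
    {ρ : Representation ℂ G V} (hρ : ρ.IsIrreducible) (τ : G →* (X →ₗ[ℂ] X)) {f : V →ₗ[ℂ] X} (hf0 : f ≠ 0)
    (hf : ∀ (g : G) (x : V), f (ρ g x) = τ g (f x)) : Function.Injective f := by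
  let N : Subrepresentation ρ :=
    { toSubmodule := LinearMap.ker f
      apply_mem_toSubmodule := fun g x hx => by
        rw [LinearMap.mem_ker] at hx ⊢
        rw [hf, hx, map_zero] }
  have hN : N ≠ ⊤ := by
    intro h
    apply hf0
    ext x
    have hx : x ∈ N.toSubmodule := by rw [h]; trivial
    exact hx
  haveI := hρ
  have hbot : N = ⊥ := (eq_bot_or_eq_top N).resolve_right hN
  rw [← LinearMap.ker_eq_bot]
  exact congrArg Subrepresentation.toSubmodule hbot

/-- **S3₂ WITH THE HERMITIAN HYPOTHESIS — `isAdmissible_of_holValued`.**  In the setting of the E₂ letter ★ `UnitaryCurveForms.cohIsotypicLine₂_hol`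
(`L` CM with `[L:ℚ] ≥ 4`, `ι : L →+* ℂ`, `H ∈ M₂(L)` with rational frame `ᵗ(c g)(t • H) g = diag dV`, signature `(1,1)` at `ι` and definite elsewhere read on
`diag dV`, a cone frame `𝔣` at the place of `ι`), assume moreover that `σ_{w₁} H` is HERMITIAN (`w₁ = cmPlace L ι`).  Then every irreducible smooth `σ` of
`U(H)(𝔸_{L⁺,f})` admitting a non-zero right-translation-equivariant linear map into `holCotForms₂ … 𝔣` is ADMISSIBLE.
[cite: BorelJacquet1979, §4.3 (i), §4.6] [cite: Borel1997, §8] [cite: BernsteinZelevinsky1976, §2.1] -/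
theorem isAdmissible_of_holValued (L : Type) [Field L] [NumberField L] [IsCMField L] (ι : L →+* ℂ) (H : Matrix (Fin 2) (Fin 2) L)
    (dV : Fin 2 → L) (t : L) (g : GL (Fin 2) L)
    (hg : formCongr ((IsCMField.complexConj L : L ≃ₐ[↥(maximalRealSubfield L)] L) : L →+* L) g (t • H) = Matrix.diagonal dV)
    (hpos : ∀ τ' : L →+* ℂ, InfinitePlace.mk τ' ≠ InfinitePlace.mk ι → ((Matrix.diagonal dV).map τ').PosDef)
    (h4 : 4 ≤ Module.finrank ℚ L) (hJ : (H.map (cmPlace L ι).1.embedding).IsHermitian)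
    (𝔣 : ConeFrame L H (cmPlace L ι))
    (W : Type) [AddCommGroup W] [Module ℂ W]
    (σ : Representation ℂ (finAdelic (↥(maximalRealSubfield L)) L (IsCMField.complexConj L) 2 H) W)
    (hirr : σ.IsIrreducible) (hsm : σ.IsSmooth)
    (ψ : W →ₗ[ℂ] ((adelicGroupData (↥(maximalRealSubfield L)) L (IsCMField.complexConj L) 2 H).Adelic → ℂ))
    (hψG : ∀ (k : finAdelic (↥(maximalRealSubfield L)) L (IsCMField.complexConj L) 2 H) (w : W),
      ψ (σ k w) = rightRep₂ (↥(maximalRealSubfield L)) L (IsCMField.complexConj L) H k (ψ w))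
    (hψv : ∀ w : W, ψ w ∈ holCotForms₂ (↥(maximalRealSubfield L)) L (IsCMField.complexConj L) H (IsCMField.complexConj_ne_one L)
      (UnitaryGroup.complexConj_smul_infinitePlace L) (cmPlace L ι) 𝔣)
    (hψ0 : ψ ≠ 0) : σ.IsAdmissible := by
  -- anisotropy of `H` ⇒ compact automorphic quotient; local compactness of `U(H)(𝔸)`
  obtain ⟨τ, hτ⟩ := UnitaryGroup.exists_infinitePlace_ne L h4 ι
  have hanis := S1BettiSliceExclusion.anisotropic_of_formCongr_posDef L H t g dV hg τ (hpos τ hτ)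
  haveI : CompactSpace (adelicGroupData ↥(maximalRealSubfield L) L (IsCMField.complexConj L) 2 H).automorphicQuotient :=
    UnitaryGroup.compactSpace_cmDatum_automorphicQuotient L 2 H hanis
  haveI : LocallyCompactSpace (adelicGroupData ↥(maximalRealSubfield L) L (IsCMField.complexConj L) 2 H).Adelic :=
    UnitaryGroup.locallyCompactSpace_cmDatum_Adelic L 2 H
  -- `ψ` is injective (Schur)
  have hinj : Function.Injective ψ :=
    injective_of_isIrreducible hirr (rightRep₂ (↥(maximalRealSubfield L)) L (IsCMField.complexConj L) H) hψ0 hψG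
  refine ⟨hsm, fun K _hK => ?_⟩
  -- the right-`K`-invariant holomorphic cotangent forms are finite-dimensional
  haveI hfin := finite_holCotForms₂_inf_fixedPoints (↥(maximalRealSubfield L)) L (IsCMField.complexConj L) H (IsCMField.complexConj_ne_one L)
    (UnitaryGroup.complexConj_smul_infinitePlace L) (cmPlace L ι) 𝔣 hJ (K : Subgroup _) K.isOpen
  -- `ψ` maps `W^K` into them
  have hmem : ∀ w ∈ σ.fixedPoints (K : Subgroup _), ψ w ∈ holCotForms₂ (↥(maximalRealSubfield L)) L (IsCMField.complexConj L) H
      (IsCMField.complexConj_ne_one L) (UnitaryGroup.complexConj_smul_infinitePlace L) (cmPlace L ι) 𝔣 ⊓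
      (rightRep₂ (↥(maximalRealSubfield L)) L (IsCMField.complexConj L) H).fixedPoints (K : Subgroup _) := by
    intro w hw
    refine ⟨hψv w, (Representation.mem_fixedPoints _ _ _).2 fun k hk => ?_⟩
    rw [← hψG, (Representation.mem_fixedPoints _ _ _).1 hw k hk]
  let ψK : σ.fixedPoints (K : Subgroup _) →ₗ[ℂ] ↥(holCotForms₂ (↥(maximalRealSubfield L)) L (IsCMField.complexConj L) H
      (IsCMField.complexConj_ne_one L) (UnitaryGroup.complexConj_smul_infinitePlace L) (cmPlace L ι) 𝔣 ⊓
      (rightRep₂ (↥(maximalRealSubfield L)) L (IsCMField.complexConj L) H).fixedPoints (K : Subgroup _)) :=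
    LinearMap.codRestrict _ (ψ.comp (σ.fixedPoints (K : Subgroup _)).subtype) fun w => hmem w.1 w.2
  have hψK : Function.Injective ψK := by
    intro w w' h
    apply Subtype.ext
    apply hinj
    have h' := congrArg Subtype.val h
    exact h'
  exact Module.Finite.of_injective ψK hψK

/-- **S3₂ IN THE CUT'S SHAPE — `isAdmissible_of_holValued_of_im_eq_zero`.**  The census cut `AdmissibleOfHolValuedType₂` (F0P5-p02 (g2) draft
`KE2/HLiu418E2Cuts.draft.v1` :146–) with the ONE extra binder `(hτt' : (ι t).im = 0)` (present in every consumer prefix: `S1BettiShape`,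
`S1MultOneFormsShape`, `S1bHodgeShape`), from which `σ_{w} H` is hermitian for every complex embedding (★ `CurveHodgeTypesDisjoint.isHermitian_map_of_formCongr`);
the binders `dV`-reality, `t ≠ 0`, the signature clause, the automorphic measure, the discrete `P` and the `P.ContainsFun` clause are carried unused.
[cite: BorelJacquet1979, §4.3 (i), §4.6] [cite: Borel1997, §8] [cite: BernsteinZelevinsky1976, §2.1] -/
theorem isAdmissible_of_holValued_of_im_eq_zero :
    ∀ (L : Type) [Field L] [NumberField L] [IsCMField L] (ι : L →+* ℂ) (H : Matrix (Fin 2) (Fin 2) L)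
    (dV : Fin 2 → L) (_hdV : ∀ i, IsCMField.complexConj L (dV i) = dV i) (_hdV0 : ∀ i, dV i ≠ 0)
    (t : L) (_ht : t ≠ 0) (_hτt' : (ι t).im = 0) (g : GL (Fin 2) L),
    formCongr ((IsCMField.complexConj L : L ≃ₐ[↥(maximalRealSubfield L)] L) : L →+* L) g (t • H) = Matrix.diagonal dV →
    (∃ T : GL (Fin 2) ℂ, formCongr (starRingEnd ℂ) T ((Matrix.diagonal dV).map ι) = Matrix.diagonal ![(1 : ℂ), -1]) →
    (∀ τ' : L →+* ℂ, InfinitePlace.mk τ' ≠ InfinitePlace.mk ι → ((Matrix.diagonal dV).map τ').PosDef) →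
    4 ≤ Module.finrank ℚ L →
    ∀ (𝔣 : ConeFrame L H (cmPlace L ι))
      (μ : Measure (adelicGroupData (↥(maximalRealSubfield L)) L (IsCMField.complexConj L) 2 H).automorphicQuotient)
      [(adelicGroupData (↥(maximalRealSubfield L)) L (IsCMField.complexConj L) 2 H).IsAutomorphicMeasure μ]
      (P : DiscreteAutomorphicRep (adelicGroupData (↥(maximalRealSubfield L)) L (IsCMField.complexConj L) 2 H) μ)
      (W : Type) [AddCommGroup W] [Module ℂ W]
      (σ : Representation ℂ (finAdelic (↥(maximalRealSubfield L)) L (IsCMField.complexConj L) 2 H) W),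
      σ.IsIrreducible → σ.IsSmooth →
    ∀ ψ : W →ₗ[ℂ] ((adelicGroupData (↥(maximalRealSubfield L)) L (IsCMField.complexConj L) 2 H).Adelic → ℂ),
      (∀ (k : finAdelic (↥(maximalRealSubfield L)) L (IsCMField.complexConj L) 2 H) (w : W),
          ψ (σ k w) = rightRep₂ (↥(maximalRealSubfield L)) L (IsCMField.complexConj L) H k (ψ w)) →
      (∀ w : W, ψ w ∈ holCotForms₂ (↥(maximalRealSubfield L)) L (IsCMField.complexConj L) H (IsCMField.complexConj_ne_one L)
          (UnitaryGroup.complexConj_smul_infinitePlace L) (cmPlace L ι) 𝔣 ∧ P.ContainsFun (ψ w)) →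
      ψ ≠ 0 → σ.IsAdmissible := by
  intro L _ _ _ ι H dV hdV _ t ht hτt' g hg _ hpos h4 𝔣 μ _ P W _ _ σ hirr hsm ψ hψG hψv hψ0
  exact isAdmissible_of_holValued L ι H dV t g hg hpos h4
    (CurveHodgeTypesDisjoint.isHermitian_map_of_formCongr L ι H t ht hτt' g dV hdV hg _) 𝔣 W σ hirr hsm ψ hψG (fun w => (hψv w).1) hψ0

end Summit.HodgeConjecture.HodgeConjecture.Cruxes.HLiu418.E2Admissible

end
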